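import Literature.LinearAlgebra.Matrix.DeterminantLowRankDefect
import HarnessLib

/-!
# Crux `BirComplexStableXYR`, line `fat-gaussian-defect-calculus`: stub S4 `stub_gaussianDefectCost`

Registered stub (lead a4, skeleton `Cruxes/BirComplexStableXYR/Lines/fat_gaussian_defect_calculus.lean`,
sha 4a864d25…): **a `(1−ε)`-subcritical positive semidefinite defect of rank `≤ k` costs at most
`ε^{−k}` in determinant** —

  `∀ ι Q D ε k, 0 < ε → ε ≤ 1 → Q ≻ 0 → D ⪰ 0 → (1−ε)Q − D ⪰ 0 → rank D ≤ k → ε^k · det Q ≤ det (Q − D)`.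

This is the Literature fact `Literature.LinearAlgebra.Matrix.pow_mul_det_le_det_sub`
(`Literature/LinearAlgebra/Matrix/DeterminantLowRankDefect.lean`: whitening by `Q^{-1/2}`, spectral
theorem, at most `k` nonzero eigenvalues of the whitened defect, each `≤ 1 − ε`), restated verbatim
in the registered signature (escalated route prover, seat 0).  No definitions; sorry-free.
-/

set_option linter.dupNamespace false -- summit = problem name (single-conjunct summit), D-0017

namespace Summit.HubbardSuperconductivity.HubbardSuperconductivity.Theorems.FatGaussian

/-- **Stub S4 `stub_gaussianDefectCost` (registered signature, verbatim)**: for real matrices,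
`Q ≻ 0`, `D ⪰ 0`, `(1 − ε)Q − D ⪰ 0`, `0 < ε ≤ 1`, `rank D ≤ k` ⟹ `ε^k · det Q ≤ det(Q − D)`.
[cite: HornJohnson2013, Thm. 4.1.5 & Cor. 4.3.12 (spectral theorem, eigenvalue monotonicity; determinant form folklore)] -/
theorem stub_gaussianDefectCost :
    ∀ (ι : Type) [Fintype ι] [DecidableEq ι] (Q D : Matrix ι ι ℝ) (ε : ℝ) (k : ℕ), 0 < ε → ε ≤ 1 → Q.PosDef → D.PosSemidef → ((1 - ε) • Q - D).PosSemidef → D.rank ≤ k → ε ^ k * Q.det ≤ (Q - D).det :=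
  fun _ _ _ Q D ε k hε hε1 hQ hD hsub hk =>
    Literature.LinearAlgebra.Matrix.pow_mul_det_le_det_sub Q D ε k hε hε1 hQ hD hsub hk

end Summit.HubbardSuperconductivity.HubbardSuperconductivity.Theorems.FatGaussian
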